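import Literature.MathematicalPhysics.QuantumFieldTheory.Balaban1983to89.B9Thm311DeltaPrimePos

/-!
# `Balaban1983to89.Node00.OpsYQOnto` — [B9] (3.14)–(3.16), (3.123), (3.132): def-Y's covariant averaging `Q(U)` IS ONTO and `Q*(U)` IS INJECTIVE at
# EVERY configuration `U` (exact finite algebra, no small field); hence `Q G Q*(U)` is POSITIVE DEFINITE — so a unit — for every positive definite bond
# letter `G(U)`, in particular `Q G₁ Q*(U)` once `Δ⁽¹⁾(U) = Δ_a − Δ′_π − Δ⁽²⁾_π` is positive definite

T. Bałaban, *Propagators for lattice gauge theories in a background field*, Commun. Math. Phys. **99** (1985) 389–434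
[`Balaban1985BackgroundPropagators`, "B9"]; [3] = T. Bałaban, *Propagators and renormalization transformations for lattice gauge theories. I*,
Commun. Math. Phys. **95** (1984) 17–40 [`Balaban1984PropagatorsI`]; [4] = *… II*, Commun. Math. Phys. **96** (1984) 223–250 [`Balaban1984PropagatorsII`].

statement-level skeleton of published theorems with citation tags; proofs where landed; nothing here is a claim about the
Yang–Mills mass gap

THE PRINTED LOCI (pp. 392–393, 420–423, read from the text layer `paper:balaban1985-cmp99-background-propagators` pp. 4–5, 32–35).  p. 393, (3.14)–(3.15)
(the LINEAR part `Q_j(U)A` of the non-linear average (3.13) p. 392, «compositions of j one-step averaging operators … where Q(V) is given by the explicit formula (124)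
in [5]»): the covariant averaging `Q(U)` of bond functions (a fine bond is parallel-transported to the initial point of the coarse bond and averaged with the
flat weights of [3] (1.18)); `Q*(U)` its adjoint, printed inside the quadratic form «⟨A, Q*aQA⟩» (3.16) p. 393 and as the letter `Q*` of Sect. D
((3.123), (3.126) p. 420).  p. 420, after (3.122): *"hence A = GQ\*ω, QGQ\*ω = B, ω = (QGQ\*)⁻¹B, and finally
A = GQ\*(QGQ\*)⁻¹B."* — print INVERTS `QGQ*` WITHOUT COMMENT; p. 421: *"We have to investigate also the operator (QGQ\*)⁻¹, but the analysis is very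
similar to this for the operator (Q′G′²Q′\*)⁻¹."*; p. 422: *"The operators (QGQ\*)⁻¹, or (QG₁Q\*)⁻¹, can be analyzed in the same way as the operator
(Q′G′²Q′\*)⁻¹."*; [4] p. 228 before (2.35): *"QGQ\* is positive also and an inverse is a well-defined and positive operator"* — which is exactly
`Q*` INJECTIVE (⟺ `Q` ONTO) plus `G > 0`.

WHY THIS FILE (owner-species item of def-Y's instance; consumer dag-n06-d's stage-11 certificate, edition 14
`Summits/…/BalabanUVNodesN06AtOpsYNuOfRecordV6EPairMU`).  Of def-Y's four Sect.-D units at the record, three are now DERIVED by n06-d (`Δ_{π,a}`, `Δ⁽¹⁾`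
from the form smallness (3.120), `N06SectDUnitsAtPins`) or witnessed at `U = 1` (FILE 23 §7); the fourth, `IsUnit (QGQOfY x.toKIdx (parBY …) (G1Y …) U)`
(the letter `(QG₁Q*)⁻¹` of (3.132), def-Y's `QG1QinvY`), stays a DISPLAYED binder `hUQ` there (n06-d gen-7 HANDOFF: «needs G₁ > 0 on range Q* + Q surjective»).
Its two ingredients split cleanly: `Q(U)` ONTO ∕ `Q*(U)` INJECTIVE is a property of def-Y's OWN letter `QY` (FILE 8 `Node00.OpsYDeltaA`: the transported
lift `trLiftY (qK i) (qT i parB U)` of the flat multi-level kernel `qK` = r03's `QE` of [4] (2.20)) and holds at EVERY configuration and EVERY transporter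
table by exact algebra — THIS file; `G₁(U) > 0` is Theorem-3.11 currency (n06-d ∕ n06-i ∕ n06-l's pins), entering here only as the hypothesis
`PosDefTr 1 (G U)` ∕ `PosDefTr 1 (deltaOneY … U)`.

THE MECHANISM (a transported version of r03's fine-to-coarse construction `B6SectAOntoV1.exists_constr` ∕ [4] (2.6), [3] (1.18)).  The flat kernel `qK`
has a NON-NEGATIVE, LEVEL-TRIANGULAR family of right-inverse rows: for an index bond `ι = (j, c) ∈ Λ_j` put `A_ι := liftIter j δ_c` (the `j`-fold
far-face lift of [3] (1.18), supported on the fine bonds crossing the far `c.dir`-face of the `j`-block `B^j(c₋)`); then `Σ_b qK(ι, b)A_ι(b) = 1`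
(`bondAvgIter_liftIter`), and for `ι′ ≠ ι` of level `≤ j` EVERY PRODUCT `qK(ι′, b)·A_ι(b)` vanishes — the sums vanish by `bondAvgIter_liftIter` (same
level) ∕ `bondAvgIter_liftIter_eq_zero_of_out` (lower level, cross-level vanishing (2.3)–(2.6)) and all terms are `≥ 0` (`bondAvg_nonneg`, `bondLift ≥ 0`),
so the averaging window of `ι′` and the support of `A_ι` are DISJOINT sets of fine bonds.  Disjointness survives the insertion of arbitrary bond-wise
transporters `R(T(ι, b))`: the map `h ↦ (b ↦ Σ_{ι of level n} A_ι(b)·R(T(ι, b))⁻¹h(ι))` is an exact right inverse of the transported lift ON LEVEL `n` and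
is invisible to the levels `< n`; inducting on `n` (fine to coarse, higher levels corrected by the next residual) gives ONTO, and testing `Q*g = 0` against
the rows `A_ι` from the top level down gives INJECTIVE.  Then for a trace-adjoint pair `(Q, Q*)` (n06-j `isAdjTr_QY_QsY`, `G`-valued data, `G ≤ U(N)`)
and `G(U) > 0`: `⟨Ψ, QGQ*Ψ⟩ = ⟨Q*Ψ, G Q*Ψ⟩ > 0` for `Ψ ≠ 0` — `QGQ*(U)` is `PosDefTr`, hence a unit (n06-j `isUnit_of_posDefTr`).

WHAT IS DEFINED AND PROVED (sorry-free; 1 `def` — the level-`n` transported lift `triLiftY`, a plain function; no instance, no notation; private plumbing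
`R_finset_sum`, `single_one_nonneg` and the three twins named in §2).
* §1 (generic, any normed `ℂ`-algebra `𝔸`, any real kernel `M : Y × X → ℝ` with a level function `lv : Y → ℕ` and rows `A : Y → X → ℝ` satisfying
  `hdiag : Σ_x M(y, x)A_y(x) = 1`, `hoff : y′ ≠ y → lv y′ ≤ lv y → M(y′, x)A_y(x) = 0`): `triLiftY`, `trLiftY_triLiftY_apply`, `trLiftY_triLiftY_of_eq` ∕
  `trLiftY_triLiftY_of_lt` (exact right inverse on level `n`, zero below), `exists_trLiftY_eq_below`, ★ `trLiftY_surjective_of_triangular` (every transporter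
  table), `triTest_trLiftY_transpose` (the row test), ★ `trLiftY_transpose_injective_of_triangular` (every transporter table).
* §2 (def-Y's letters at a k-level index `i`): `qK_eq_toMatrix'_qFn` (dictionary to r03's `qFn`), `qK_mulVec`, `liftIter_nonneg`, `liftIter_single_cast`, `lamBond_cast`,
  `qK_liftRow_diag`, `qK_liftRow_sum_off`, `qK_liftRow_off` (termwise; private plumbing `qK_apply_single` ∕ `qK_nonneg'` ∕ `bondAvgIter_nonneg_of_nonneg` = twins of
  n06-j's `B9Thm311FlippedBondForms.qK_eq_bondAvgIter` ∕ `qK_nonneg` and `B8Prop3MultiLevelTorus.bondAvgIter_nonneg`, outside this import closure), ★★ `QY_surjective` (`Q(U)` (3.14)–(3.15) is ONTO the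
  index-bond functions, every `parB`, every `U`), `QY_rightInverse`, ★★ `QsY_injective` ((3.16)∕(3.123) `Q*(U)` is injective, every `parB`, every `U`).
* §3 (trace currency, `𝔸 = M_N(ℂ)`): `posDefTr_sandwich_of_isAdjTr` (`G > 0`, `(Q, Q*)` adjoint, `Q*` injective ⟹ `QGQ* > 0`), ★★ `posDefTr_QGQOfY`
  (any `G`-valued table `parB`, `G ≤ U(N)`, any letter `G(U) > 0`), `posDefTr_QGQOfY_parBY`, ★★ `isUnit_QGQOfY_of_posDefTr` ∕ `isUnit_QGQOfY_parBY_of_posDefTr`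
  ((3.123)∕(3.132): `QGQ*(U)` is a unit), `posDefTr_QGQOfY_G1Y_of_posDefTr_deltaOneY`, ★★★ `isUnit_QGQOfY_G1Y_of_posDefTr_deltaOneY` (the displayed unit
  `hUQ` of n06-d's edition 14 from `PosDefTr 1 (deltaOneY …)` alone: `G₁ = Ring.inverse Δ⁽¹⁾` is then positive definite by n06-j `posDefTr_ringInverse`),
  `posDefTr_sub_of_form_small` ((3.137)–(3.138) in trace currency: `T > 0`, `⟨Φ,DΦ⟩ ≤ r⟨Φ,TΦ⟩`, `r < 1` ⟹ `T − D > 0`), `posDefTr_deltaOneY_of_form_small`,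
  `isUnit_QGQOfY_G1Y_of_form_small` (the unit from `Δ_{π,a} > 0` + form-smallness of `Δ⁽²⁾_π`), and the consumer-shaped `isUnit_QGQOfY_G1Y_record_of_posDefTr`
  at the tables of record `parSymY ∕ parBY ∕ GpY (parSymY)`.

NEAREST PRIOR ART IN THE TREE (not duplicated).  `B6SectAVectorModelV1.QE_surjective ∕ QsE_injective` (r03: the FLAT `U = 1` case on `ℓ²`, via
`exists_constr`) — the level-triangular rows used here ARE r03's, read termwise; `B9Eq3132SectDLetters.isUnit_QGQY_one` ∕ FILE 23 `isUnit_QGQOfY_G1Y_one`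
(`U = 1` only); `B9Eq315QTorusOnto.QtorusLin_surjective` (cell pub-balaban: ONE averaging step of the DERIVATIVE-defined `Q(V)` of [5] (124) on `ℤ^d`-periodic
carriers, onto in the SMALL-FIELD regime by a Neumann series) — a different letter on different carriers; def-Y's (3.14)–(3.15) reading `QY` (single
transport of the flat kernel) is onto at every `U` with no smallness.

HONEST SCOPE.  Exact finite-dimensional linear algebra over a normed algebra (a triangular system with unit diagonal is solvable; a positive form has
trivial kernel); NO inequality of [B9] asserted; the positivity `G₁(U) > 0` ∕ `Δ⁽¹⁾(U) > 0` ((3.120), (3.137)–(3.138), Theorem 3.11) is NOT claimed — it is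
the hypothesis of §3, to be supplied in Theorem-3.11 currency by the N06 seats; nothing about the RANGE restriction of (3.156).  NOT a node discharge, NOT
summit progress; count-neutral; one finite-torus algebra at fixed lattice spacing — nothing continuum, nothing about reflection positivity or the mass gap.
Cell `pub-ymgap` (HUMAN RULING D-0062), Track A NODE 00 definer row def-Y (successor gen 12), 2026-08-27.
-/

noncomputable section

namespace Literature.MathematicalPhysics.QuantumFieldTheory.Balaban1983to89.Node00

open B6KLevelCensusIndexV1 (KIdx)
open B6GlobalChartV1 (PV domT)
open B9Thm311ReadingCoords (trIP PosDefTr IsAdjTr isUnit_of_posDefTr)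
open B9Ineq349SiteAdjoint (trIP_comm)
open B9Thm311AdjointPairs (isAdjTr_QY_QsY isAdjTr_QY_QsY_parBY)
open B9Thm311DeltaPrimePos (posDefTr_ringInverse trIP_add_right)
open B9Eq3132SectDLetters (deltaPiAY)
open B9Eq39Adjoint (R R_smul R_R_inv R_inv_R R_zero)
open LatticeFieldCalculus (bondAvg bondAvgIter)
open B5Eq120IterProof (bondAvgIter_zero bondAvgIter_succ)
open B5AveragingOnto (bondLift)
open B6SectAOntoV1 (liftIter liftIter_zero liftIter_succ bondAvgIter_liftIter bondAvgIter_liftIter_eq_zero_of_out out_of_not_deep)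
open B6SectAOperatorsV1 (qFn QE BondIdx)
open B6Ineq2133TwoScaleV1 (onFun onFun_onE)
open B6QppKernelV1 (bondAvg_nonneg)
open scoped Matrix

/-! ## §1 Generic: a transported lift whose flat kernel has non-negative level-triangular right-inverse rows is ONTO; the transposed lift is INJECTIVE -/

section Triangular

variable {𝔸 : Type} [NormedRing 𝔸] [NormedAlgebra ℂ 𝔸] [CompleteSpace 𝔸]
variable {X Y : Type} [Fintype X] [Fintype Y]

omit [CompleteSpace 𝔸] [Fintype X] [Fintype Y] in
/-- `R(V)` commutes with finite sums (it is the linear map `RL V`). [folklore] -/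
private theorem R_finset_sum {ι : Type} (V : 𝔸ˣ) (s : Finset ι) (f : ι → 𝔸) : R V (∑ j ∈ s, f j) = ∑ j ∈ s, R V (f j) :=
  map_sum (RL V) f s

variable (lv : Y → ℕ) (A : Y → X → ℝ)

/-- the LEVEL-`n` TRANSPORTED LIFT built from right-inverse rows `A_y`: `(𝔏ₙh)(x) = Σ_{lv y = n} A_y(x)·R(T(y, x))⁻¹ h(y)` — the transported reading of
[3] (1.18)'s far-face lift (one level of [4] (2.6)'s fine-to-coarse construction). [cite: Balaban1984PropagatorsI, (1.18) p.20; Balaban1984PropagatorsII, (2.6) p.224; Balaban1985BackgroundPropagators, (3.14)–(3.15) p.393] -/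
def triLiftY (T : Y → X → 𝔸ˣ) (n : ℕ) (h : Y → 𝔸) : X → 𝔸 :=
  fun x => ∑ y ∈ Finset.univ.filter (fun y => lv y = n), ((A y x : ℝ) : ℂ) • R (T y x)⁻¹ (h y)

variable {lv A} {M : Matrix Y X ℝ}

omit [CompleteSpace 𝔸] in
/-- the transported lift of the level-`n` lift, expanded: `(M♯_T 𝔏ₙh)(y′) = Σ_{lv y = n} Σ_x (M(y′,x)A_y(x)) • R(T(y′,x))R(T(y,x))⁻¹h(y)`.
[cite: Balaban1984PropagatorsII, (2.6) p.224, bookkeeping] -/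
theorem trLiftY_triLiftY_apply (T : Y → X → 𝔸ˣ) (n : ℕ) (h : Y → 𝔸) (y' : Y) :
    trLiftY M T (triLiftY lv A T n h) y' =
      ∑ y ∈ Finset.univ.filter (fun y => lv y = n), ∑ x, ((M y' x * A y x : ℝ) : ℂ) • R (T y' x) (R (T y x)⁻¹ (h y)) := by
  rw [trLiftY_apply, Finset.sum_comm]
  refine Finset.sum_congr rfl fun x _ => ?_
  simp only [triLiftY]
  rw [R_finset_sum, Finset.smul_sum]
  refine Finset.sum_congr rfl fun y _ => ?_
  rw [R_smul, smul_smul, Complex.ofReal_mul]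

omit [CompleteSpace 𝔸] in
/-- ★ ON LEVEL `n` THE LEVEL-`n` LIFT IS AN EXACT RIGHT INVERSE: `(M♯_T 𝔏ₙh)(y′) = h(y′)` for `lv y′ = n` — the transports cancel on the diagonal
(`R(T)R(T)⁻¹ = 1`), every off-diagonal product `M(y′,x)A_y(x)` vanishes. [cite: Balaban1984PropagatorsI, (1.18) p.20 («Q_k ∘ lift = id»); Balaban1985BackgroundPropagators, (3.14)–(3.15) p.393] -/
theorem trLiftY_triLiftY_of_eq (hdiag : ∀ y, ∑ x, M y x * A y x = 1) (hoff : ∀ y y', y' ≠ y → lv y' ≤ lv y → ∀ x, M y' x * A y x = 0)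
    (T : Y → X → 𝔸ˣ) {n : ℕ} (h : Y → 𝔸) {y' : Y} (hy' : lv y' = n) : trLiftY M T (triLiftY lv A T n h) y' = h y' := by
  rw [trLiftY_triLiftY_apply, Finset.sum_eq_single y']
  · simp only [R_R_inv]
    rw [← Finset.sum_smul, ← Complex.ofReal_sum, hdiag y', Complex.ofReal_one, one_smul]
  · intro y hy hne
    have hle : lv y' ≤ lv y := (hy'.trans (Finset.mem_filter.mp hy).2.symm).le
    exact Finset.sum_eq_zero fun x _ => by rw [hoff y y' hne.symm hle x, Complex.ofReal_zero, zero_smul]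
  · intro hmem
    exact (hmem (Finset.mem_filter.mpr ⟨Finset.mem_univ _, hy'⟩)).elim

omit [CompleteSpace 𝔸] in
/-- ★ BELOW LEVEL `n` THE LEVEL-`n` LIFT IS INVISIBLE: `(M♯_T 𝔏ₙh)(y′) = 0` for `lv y′ < n` (cross-level vanishing, termwise).
[cite: Balaban1984PropagatorsII, (2.3)–(2.6) p.224; Balaban1985BackgroundPropagators, (3.14)–(3.15) p.393] -/
theorem trLiftY_triLiftY_of_lt (hoff : ∀ y y', y' ≠ y → lv y' ≤ lv y → ∀ x, M y' x * A y x = 0)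
    (T : Y → X → 𝔸ˣ) {n : ℕ} (h : Y → 𝔸) {y' : Y} (hy' : lv y' < n) : trLiftY M T (triLiftY lv A T n h) y' = 0 := by
  rw [trLiftY_triLiftY_apply]
  refine Finset.sum_eq_zero fun y hy => ?_
  have hn : lv y = n := (Finset.mem_filter.mp hy).2
  have hne : y' ≠ y := fun hyy => by rw [hyy, hn] at hy'; exact lt_irrefl _ hy'
  have hle : lv y' ≤ lv y := by rw [hn]; exact hy'.le
  exact Finset.sum_eq_zero fun x _ => by rw [hoff y y' hne hle x, Complex.ofReal_zero, zero_smul]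

omit [CompleteSpace 𝔸] in
/-- the fine-to-coarse induction of [4] (2.6), transported: after `n` steps the constraints of all levels `< n` are met.
[cite: Balaban1984PropagatorsII, (2.6) p.224; Balaban1985BackgroundPropagators, (3.14)–(3.15) p.393] -/
theorem exists_trLiftY_eq_below (hdiag : ∀ y, ∑ x, M y x * A y x = 1) (hoff : ∀ y y', y' ≠ y → lv y' ≤ lv y → ∀ x, M y' x * A y x = 0)
    (T : Y → X → 𝔸ˣ) (h : Y → 𝔸) (n : ℕ) : ∃ F : X → 𝔸, ∀ y', lv y' < n → trLiftY M T F y' = h y' := by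
  induction n with
  | zero => exact ⟨0, fun _ h0 => absurd h0 (Nat.not_lt_zero _)⟩
  | succ n ih =>
    obtain ⟨F, hF⟩ := ih
    refine ⟨F + triLiftY lv A T n (fun y => h y - trLiftY M T F y), fun y' hy' => ?_⟩
    rw [map_add, Pi.add_apply]
    rcases Nat.lt_succ_iff_lt_or_eq.mp hy' with hlt | heq
    · rw [hF y' hlt, trLiftY_triLiftY_of_lt hoff T _ hlt, add_zero]
    · rw [trLiftY_triLiftY_of_eq hdiag hoff T _ heq, add_sub_cancel]

omit [CompleteSpace 𝔸] in
/-- ★★ **A TRANSPORTED LIFT WHOSE FLAT KERNEL HAS LEVEL-TRIANGULAR RIGHT-INVERSE ROWS IS ONTO — FOR EVERY TRANSPORTER TABLE.**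
[cite: Balaban1984PropagatorsII, (2.6) p.224 + (2.35) p.228 («an inverse is a well-defined … operator»); Balaban1985BackgroundPropagators, (3.123) p.420 («ω = (QGQ*)⁻¹B»)] -/
theorem trLiftY_surjective_of_triangular (hdiag : ∀ y, ∑ x, M y x * A y x = 1)
    (hoff : ∀ y y', y' ≠ y → lv y' ≤ lv y → ∀ x, M y' x * A y x = 0) (T : Y → X → 𝔸ˣ) : Function.Surjective (trLiftY M T) := by
  intro h
  obtain ⟨F, hF⟩ := exists_trLiftY_eq_below hdiag hoff T h (Finset.univ.sup lv + 1)
  exact ⟨F, funext fun y' => hF y' (Nat.lt_succ_of_le (Finset.le_sup (f := lv) (Finset.mem_univ y')))⟩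

omit [CompleteSpace 𝔸] in
/-- THE ROW TEST for the transposed lift along any table `S`: `Σ_x A_{y₀}(x)·R(S(x,y₀))⁻¹((Mᵀ♯_S g)(x)) = g(y₀) + (terms from levels > lv y₀)`.
[cite: Balaban1984PropagatorsII, (2.35) p.228 («Q* … injective» reading); Balaban1985BackgroundPropagators, (3.16) p.393 (`Q*` inside `⟨A, Q*aQA⟩`)] -/
theorem triTest_trLiftY_transpose (hdiag : ∀ y, ∑ x, M y x * A y x = 1)
    (hoff : ∀ y y', y' ≠ y → lv y' ≤ lv y → ∀ x, M y' x * A y x = 0) (S : X → Y → 𝔸ˣ) (g : Y → 𝔸) (y₀ : Y) :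
    ∑ x, ((A y₀ x : ℝ) : ℂ) • R (S x y₀)⁻¹ (trLiftY Mᵀ S g x) =
      g y₀ + ∑ y ∈ Finset.univ.filter (fun y => lv y₀ < lv y), ∑ x, ((A y₀ x * M y x : ℝ) : ℂ) • R (S x y₀)⁻¹ (R (S x y) (g y)) := by
  have hexp : ∑ x, ((A y₀ x : ℝ) : ℂ) • R (S x y₀)⁻¹ (trLiftY Mᵀ S g x) =
      ∑ y, ∑ x, ((A y₀ x * M y x : ℝ) : ℂ) • R (S x y₀)⁻¹ (R (S x y) (g y)) := by
    rw [Finset.sum_comm]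
    refine Finset.sum_congr rfl fun x _ => ?_
    rw [trLiftY_apply, R_finset_sum, Finset.smul_sum]
    refine Finset.sum_congr rfl fun y _ => ?_
    rw [R_smul, smul_smul, Matrix.transpose_apply, Complex.ofReal_mul]
  have hlow : ∑ y ∈ Finset.univ.filter (fun y => ¬ lv y₀ < lv y), ∑ x, ((A y₀ x * M y x : ℝ) : ℂ) • R (S x y₀)⁻¹ (R (S x y) (g y)) = g y₀ := by
    rw [Finset.sum_eq_single y₀]
    · simp only [R_inv_R]
      rw [← Finset.sum_smul, ← Complex.ofReal_sum]
      simp_rw [mul_comm (A y₀ _) (M y₀ _)]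
      rw [hdiag y₀, Complex.ofReal_one, one_smul]
    · intro y hy hne
      have hle : lv y ≤ lv y₀ := not_lt.mp (Finset.mem_filter.mp hy).2
      exact Finset.sum_eq_zero fun x _ => by rw [mul_comm, hoff y₀ y hne hle x, Complex.ofReal_zero, zero_smul]
    · intro h0
      exact (h0 (Finset.mem_filter.mpr ⟨Finset.mem_univ _, lt_irrefl _⟩)).elim
  rw [hexp, ← Finset.sum_filter_add_sum_filter_not Finset.univ (fun y => lv y₀ < lv y), hlow, add_comm]

omit [CompleteSpace 𝔸] in
/-- ★★ **THE TRANSPOSED LIFT ALONG ANY TRANSPORTER TABLE IS INJECTIVE** (test `Mᵀ♯_S g = 0` against the rows `A_y` from the top level down).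
[cite: Balaban1984PropagatorsII, (2.35) p.228 («QGQ* is positive also and an inverse is a well-defined and positive operator»); Balaban1985BackgroundPropagators, (3.16) p.393 (`Q*` inside `⟨A, Q*aQA⟩`)] -/
theorem trLiftY_transpose_injective_of_triangular (hdiag : ∀ y, ∑ x, M y x * A y x = 1)
    (hoff : ∀ y y', y' ≠ y → lv y' ≤ lv y → ∀ x, M y' x * A y x = 0) (S : X → Y → 𝔸ˣ) : Function.Injective (trLiftY Mᵀ S) := by
  refine (injective_iff_map_eq_zero _).mpr fun g hg => ?_
  -- descending induction on the level: `g = 0` on the levels `≥ N − k`, `N` the top level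
  have key : ∀ k : ℕ, ∀ y, Finset.univ.sup lv - k ≤ lv y → g y = 0 := by
    intro k
    induction k with
    | zero =>
      intro y hy
      have htest := triTest_trLiftY_transpose hdiag hoff S g y
      rw [hg] at htest
      simp only [Pi.zero_apply, R_zero, smul_zero, Finset.sum_const_zero] at htest
      rw [Finset.sum_eq_zero, add_zero] at htest
      · exact htest.symm
      · intro y' hy'
        have hlt : lv y < lv y' := (Finset.mem_filter.mp hy').2
        have hle : lv y' ≤ Finset.univ.sup lv := Finset.le_sup (f := lv) (Finset.mem_univ y')
        omega
    | succ k ih =>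
      intro y hy
      have htest := triTest_trLiftY_transpose hdiag hoff S g y
      rw [hg] at htest
      simp only [Pi.zero_apply, R_zero, smul_zero, Finset.sum_const_zero] at htest
      rw [Finset.sum_eq_zero, add_zero] at htest
      · exact htest.symm
      · intro y' hy'
        have hlt : lv y < lv y' := (Finset.mem_filter.mp hy').2
        refine Finset.sum_eq_zero fun x _ => ?_
        rw [ih y' (by omega), R_zero, R_zero, smul_zero]
  funext y
  exact key (Finset.univ.sup lv) y (by omega)

end Triangular

/-! ## §2 def-Y's letters: `Q(U)` (3.14)–(3.15) is ONTO and `Q*(U)` ((3.16), (3.123)) is INJECTIVE at every configuration and every transporter table -/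

section Letters

variable {d ℓ : ℕ} {hd : 1 ≤ d + 1} {hL : Odd (ℓ + 1) ∧ 1 < ℓ + 1} {b₀ b₁ : ℝ}
variable {𝔸 : Type} [NormedRing 𝔸] [NormedAlgebra ℂ 𝔸] [CompleteSpace 𝔸]
variable (i : KIdx d ℓ hd hL b₀ b₁)

/-- DICTIONARY: def-Y's flat averaging kernel `qK` IS the matrix of r03's multi-scale `Q` on functions (`qFn`, [4] (2.20)).
[cite: Balaban1984PropagatorsII, (2.20) p.226; Balaban1985BackgroundPropagators, (3.14)–(3.15) p.393, dictionary] -/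
theorem qK_eq_toMatrix'_qFn : qK i = LinearMap.toMatrix' (qFn (domT i.hN i.D i.hk)) := by
  show LinearMap.toMatrix' (onFun (QE (domT i.hN i.D i.hk))) = _
  rw [QE, onFun_onE]

/-- the kernel entry `qK(ι, b)` is the `ι`-average of the indicator of the fine bond `b` — a PRIVATE twin of n06-j's
`B9Thm311FlippedBondForms.qK_eq_bondAvgIter` (same statement; that file is outside this import closure and is not pulled in for one line). [folklore] -/
private theorem qK_apply_single (ι : IBondY i) (b : FBondY i) : qK i ι b = bondAvgIter (ι.1.1 : ℕ) (Pi.single b (1 : ℝ)) ι.1.2 := by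
  rw [qK_eq_toMatrix'_qFn, LinearMap.toMatrix'_apply]; rfl

/-- `qK♯A = (Q_jA)(c)` at `ι = (j, c)`. [cite: Balaban1984PropagatorsII, (2.20) p.226, bookkeeping] -/
theorem qK_mulVec (F : FBondY i → ℝ) (ι : IBondY i) : (qK i *ᵥ F) ι = bondAvgIter (ι.1.1 : ℕ) F ι.1.2 := by
  rw [qK_eq_toMatrix'_qFn, LinearMap.toMatrix'_mulVec]; rfl

/-- iterated averages of a non-negative fine field are non-negative — a PRIVATE twin of `B8Prop3MultiLevelTorus.bondAvgIter_nonneg` (outside this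
import closure; four lines from `B6QppKernelV1.bondAvg_nonneg`). [folklore] -/
private theorem bondAvgIter_nonneg_of_nonneg {P : Params} : ∀ (k : ℕ) {F : VecField P 0 ℝ}, (∀ b, 0 ≤ F b) → ∀ c, 0 ≤ bondAvgIter k F c
  | 0, _, hF, c => hF c
  | k + 1, _, hF, c => by
    rw [bondAvgIter_succ]
    exact bondAvg_nonneg (bondAvgIter_nonneg_of_nonneg k hF) c

/-- the averaging kernel is entrywise non-negative — a PRIVATE twin of n06-j's `B9Thm311FlippedBondForms.qK_nonneg` (outside this import closure). [folklore] -/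
private theorem qK_nonneg' (ι : IBondY i) (b : FBondY i) : 0 ≤ qK i ι b := by
  rw [qK_apply_single]
  refine bondAvgIter_nonneg_of_nonneg _ (fun b' => ?_) _
  by_cases h : b' = b
  · rw [h, Pi.single_eq_same]; exact zero_le_one
  · rw [Pi.single_eq_of_ne h]

/-- the `k`-fold far-face lift of a non-negative coarse field is non-negative (`bondLift` puts `L·B ≥ 0` or `0`). [cite: Balaban1984PropagatorsI, (1.11) p.19, (1.18) p.20] -/
theorem liftIter_nonneg {P : Params} : ∀ (k : ℕ) {B : VecField P k ℝ}, (∀ c, 0 ≤ B c) → ∀ b, 0 ≤ liftIter k B b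
  | 0, _, hB, b => hB b
  | k + 1, B, hB, b => by
    rw [liftIter_succ]
    refine liftIter_nonneg k (fun c => ?_) b
    unfold bondLift
    split_ifs
    · exact mul_nonneg (Nat.cast_nonneg _) (hB _)
    · exact le_refl _

/-- the indicator row is non-negative. [folklore] -/
private theorem single_one_nonneg {Z : Type} [DecidableEq Z] (z z' : Z) : 0 ≤ Pi.single (M := fun _ => ℝ) z (1 : ℝ) z' := by
  by_cases h : z' = z
  · rw [h, Pi.single_eq_same]; exact zero_le_one
  · rw [Pi.single_eq_of_ne h]

/-- THE DIAGONAL: `Σ_b qK(ι, b)·(liftIter j δ_c)(b) = 1` at `ι = (j, c)` (`Q_j ∘ liftIter j = id`, [3] (1.18)). [cite: Balaban1984PropagatorsI, (1.18) p.20; Balaban1984PropagatorsII, (2.6) p.224] -/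
theorem qK_liftRow_diag (ι : IBondY i) : ∑ b, qK i ι b * liftIter (ι.1.1 : ℕ) (Pi.single ι.1.2 (1 : ℝ)) b = 1 := by
  have hj : (ι.1.1 : ℕ) ≤ (PV d ℓ i.m i.K hd hL).m + (PV d ℓ i.m i.K hd hL).K :=
    ((domT i.hN i.D i.hk).le_of_lamBond ι.2).trans (domT i.hN i.D i.hk).hk
  have h := qK_mulVec i (liftIter (ι.1.1 : ℕ) (Pi.single ι.1.2 (1 : ℝ))) ι
  rw [bondAvgIter_liftIter _ hj, Pi.single_eq_same] at h
  simpa [Matrix.mulVec, dotProduct] using h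

/-- the fine-bond row of a coarse bond after an index cast `j = j′` (bookkeeping for the induction on levels). [cite: Balaban1984PropagatorsI, (1.18) p.20, bookkeeping] -/
theorem liftIter_single_cast {P : Params} {j j' : ℕ} (h : j = j') (c : PBond P j) :
    liftIter j (Pi.single c (1 : ℝ)) = liftIter j' (Pi.single (h ▸ c) (1 : ℝ)) := by
  subst h; rfl

/-- membership in `Λ_j` after an index cast. [cite: Balaban1984PropagatorsII, (2.3) p.224, bookkeeping] -/
theorem lamBond_cast {P : Params} (D : B6SectADomainsV1.Domains P) {j j' : ℕ} (h : j = j') (c : PBond P j) (hc : D.LamBond j c) :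
    D.LamBond j' (h ▸ c) := by
  subst h; exact hc

/-- the level-`j` row sum against an index bond `ι′` of level `≤ j`, `ι′ ≠ ι`, VANISHES: same level by `Q_j ∘ liftIter j = id` off the diagonal, lower
level by the cross-level vanishing of [4] (2.3)–(2.6) (`bondAvgIter_liftIter_eq_zero_of_out`: `Λ_i`-bonds are not deep).
[cite: Balaban1984PropagatorsII, (2.3)–(2.6) p.224; Balaban1984PropagatorsI, (1.18) p.20] -/
theorem qK_liftRow_sum_off (ι ι' : IBondY i) (hne : ι' ≠ ι) (hle : (ι'.1.1 : ℕ) ≤ (ι.1.1 : ℕ)) :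
    ∑ b, qK i ι' b * liftIter (ι.1.1 : ℕ) (Pi.single ι.1.2 (1 : ℝ)) b = 0 := by
  have hjk : (ι.1.1 : ℕ) ≤ (PV d ℓ i.m i.K hd hL).m + (PV d ℓ i.m i.K hd hL).K :=
    ((domT i.hN i.D i.hk).le_of_lamBond ι.2).trans (domT i.hN i.D i.hk).hk
  have hsum : ∑ b, qK i ι' b * liftIter (ι.1.1 : ℕ) (Pi.single ι.1.2 (1 : ℝ)) b =
      (qK i *ᵥ liftIter (ι.1.1 : ℕ) (Pi.single ι.1.2 (1 : ℝ))) ι' := by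
    simp [Matrix.mulVec, dotProduct]
  rw [hsum, qK_mulVec]
  rcases Nat.lt_or_eq_of_le hle with hlt | heq
  · -- lower level: cross-level vanishing ([4] (2.3)–(2.6)); write `j = n + 1`
    obtain ⟨n, hn⟩ : ∃ n, (ι.1.1 : ℕ) = n + 1 := ⟨(ι.1.1 : ℕ) - 1, by omega⟩
    have hcn : (domT i.hN i.D i.hk).LamBond (n + 1) (hn ▸ ι.1.2) := lamBond_cast _ hn _ ι.2
    rw [liftIter_single_cast hn]
    refine bondAvgIter_liftIter_eq_zero_of_out (domT i.hN i.D i.hk) (by omega) (r := Pi.single (hn ▸ ι.1.2) (1 : ℝ))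
      (fun c'' h'' => ?_) (ι'.1.1 : ℕ) (by omega) ι'.1.2
      (out_of_not_deep (domT i.hN i.D i.hk) (by omega) ι'.2.2.1) (out_of_not_deep (domT i.hN i.D i.hk) (by omega) ι'.2.2.2)
    by_cases hcc : c'' = hn ▸ ι.1.2
    · rw [hcc]; exact hcn
    · exact absurd (Pi.single_eq_of_ne hcc _) h''
  · -- same level, distinct bond: `Q_j(liftIter j δ_c)(c′) = δ_c(c′) = 0`
    obtain ⟨⟨j, c⟩, hc⟩ := ι
    obtain ⟨⟨j', c'⟩, hc'⟩ := ι'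
    have hjj : j' = j := Fin.ext heq
    subst hjj
    have hcc : c' ≠ c := fun hce => hne (Subtype.ext (by simp [hce]))
    show bondAvgIter (j' : ℕ) (liftIter (j' : ℕ) (Pi.single c (1 : ℝ))) c' = 0
    rw [bondAvgIter_liftIter _ hjk, Pi.single_eq_of_ne hcc]

/-- THE OFF-DIAGONAL, TERMWISE: for `ι′ ≠ ι` of level `≤` that of `ι`, EVERY product `qK(ι′, b)·(liftIter j δ_c)(b)` vanishes (a vanishing sum of
non-negative terms) — the averaging window of `ι′` misses the far-face support of the row of `ι`. [cite: Balaban1984PropagatorsII, (2.3)–(2.6) p.224; Balaban1984PropagatorsI, (1.11) p.19, (1.18) p.20] -/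
theorem qK_liftRow_off (ι ι' : IBondY i) (hne : ι' ≠ ι) (hle : (ι'.1.1 : ℕ) ≤ (ι.1.1 : ℕ)) (b : FBondY i) :
    qK i ι' b * liftIter (ι.1.1 : ℕ) (Pi.single ι.1.2 (1 : ℝ)) b = 0 :=
  (Finset.sum_eq_zero_iff_of_nonneg fun b _ =>
      mul_nonneg (qK_nonneg' i ι' b) (liftIter_nonneg _ (fun c => single_one_nonneg _ c) b)).mp
    (qK_liftRow_sum_off i ι ι' hne hle) b (Finset.mem_univ b)

/-- ★★ **`Q(U)` OF (3.14)–(3.15) IS ONTO the index-bond functions — at EVERY configuration `U` and EVERY bond transporter table `parB`** (exact algebra: the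
transported fine-to-coarse construction; no small-field condition). [cite: Balaban1985BackgroundPropagators, (3.14)–(3.15) p.393, (3.123) p.420 («ω = (QGQ*)⁻¹B»); Balaban1984PropagatorsII, (2.6) p.224] -/
theorem QY_surjective (parB : BondParY 𝔸 i) (U : CfgY 𝔸 i) : Function.Surjective (QY i parB U) :=
  trLiftY_surjective_of_triangular (M := qK i) (lv := fun ι : IBondY i => (ι.1.1 : ℕ))
    (A := fun ι b => liftIter (ι.1.1 : ℕ) (Pi.single ι.1.2 (1 : ℝ)) b)
    (qK_liftRow_diag i) (fun ι ι' hne hle b => qK_liftRow_off i ι ι' hne hle b) (qT i parB U)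

/-- `Q(U)` has a right inverse as a FUNCTION (choice): `Q(U) ∘ σ = id`. [cite: Balaban1985BackgroundPropagators, (3.126) p.420 («HB = GQ*(QGQ*)⁻¹B»), bookkeeping] -/
theorem QY_rightInverse (parB : BondParY 𝔸 i) (U : CfgY 𝔸 i) :
    Function.RightInverse (Function.surjInv (QY_surjective i parB U)) (QY i parB U) :=
  Function.rightInverse_surjInv _

/-- ★★ **`Q*(U)` OF (3.16)∕(3.123) IS INJECTIVE — at EVERY configuration and EVERY bond transporter table.**
[cite: Balaban1985BackgroundPropagators, (3.16) p.393 (`Q*` inside `⟨A, Q*aQA⟩`), (3.123) p.420; Balaban1984PropagatorsII, (2.35) p.228 («QGQ* is positive also and an inverse is a well-defined and positive operator»)] -/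
theorem QsY_injective (parB : BondParY 𝔸 i) (U : CfgY 𝔸 i) : Function.Injective (QsY i parB U) := by
  rw [QsY_eq_transpose]
  exact trLiftY_transpose_injective_of_triangular (M := qK i) (lv := fun ι : IBondY i => (ι.1.1 : ℕ))
    (A := fun ι b => liftIter (ι.1.1 : ℕ) (Pi.single ι.1.2 (1 : ℝ)) b)
    (qK_liftRow_diag i) (fun ι ι' hne hle b => qK_liftRow_off i ι ι' hne hle b) _

end Letters

/-! ## §3 Trace currency: `Q G Q*(U)` is positive definite — hence a unit — for every positive definite letter `G(U)` -/

section Positive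

open scoped Matrix.Norms.L2Operator

variable {N : ℕ} {S S' : Type} [Fintype S] [Fintype S']

/-- **THE SANDWICH**: `G > 0`, `(Q, Q*)` a trace-adjoint pair and `Q*` injective ⟹ `QGQ* > 0` (`⟨Ψ, QGQ*Ψ⟩ = ⟨Q*Ψ, GQ*Ψ⟩ > 0`).
[cite: Balaban1984PropagatorsII, (2.35) p.228 («QGQ* is positive also»); Balaban1985BackgroundPropagators, (3.123) p.420] -/
theorem posDefTr_sandwich_of_isAdjTr {wX : S → ℝ} {wY : S' → ℝ} {Q : (S → Matrix (Fin N) (Fin N) ℂ) →ₗ[ℂ] (S' → Matrix (Fin N) (Fin N) ℂ)}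
    {Qs : (S' → Matrix (Fin N) (Fin N) ℂ) →ₗ[ℂ] (S → Matrix (Fin N) (Fin N) ℂ)} {G : (S → Matrix (Fin N) (Fin N) ℂ) →ₗ[ℂ] (S → Matrix (Fin N) (Fin N) ℂ)}
    (hQ : IsAdjTr wX wY Q Qs) (hQs : Function.Injective Qs) (hG : PosDefTr wX G) : PosDefTr wY (Q ∘ₗ G ∘ₗ Qs) := by
  intro Ψ hΨ
  have hne : Qs Ψ ≠ 0 := fun h0 => hΨ (hQs (by rw [h0, map_zero]))
  simp only [LinearMap.comp_apply]
  rw [trIP_comm wY, hQ, trIP_comm wX]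
  exact hG _ hne

variable {d ℓ : ℕ} {hd : 1 ≤ d + 1} {hL : Odd (ℓ + 1) ∧ 1 < ℓ + 1} {b₀ b₁ : ℝ}
variable (i : KIdx d ℓ hd hL b₀ b₁)

/-- ★★ **`Q G Q*(U)` IS POSITIVE DEFINITE** for every bond letter with `G(U) > 0`, at a `G`-valued bond transporter table, `G ≤ U(N)`.
[cite: Balaban1985BackgroundPropagators, (3.123) p.420, (3.132) p.422; Balaban1984PropagatorsII, (2.35) p.228] -/
theorem posDefTr_QGQOfY {G : Subgroup (Matrix (Fin N) (Fin N) ℂ)ˣ} (hG : G ≤ B7Prop2Explicit.unitaryUnits (Matrix (Fin N) (Fin N) ℂ))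
    (parB : BondParY (Matrix (Fin N) (Fin N) ℂ) i) (U : CfgY (Matrix (Fin N) (Fin N) ℂ) i) (hpar : ∀ s s', parB U s s' ∈ G)
    (Gop : BondOpY (Matrix (Fin N) (Fin N) ℂ) i) (hpos : PosDefTr (fun _ => (1 : ℝ)) (Gop U)) :
    PosDefTr (fun _ => (1 : ℝ)) (QGQOfY i parB Gop U) :=
  posDefTr_sandwich_of_isAdjTr (isAdjTr_QY_QsY i hG parB U hpar) (QsY_injective i parB U) hpos

/-- `Q G Q*(U) > 0` at def-Y's taxicab table `parBY` and a `G`-valued configuration. [cite: Balaban1985BackgroundPropagators, (3.123) p.420, (3.35) p.396] -/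
theorem posDefTr_QGQOfY_parBY {G : Subgroup (Matrix (Fin N) (Fin N) ℂ)ˣ} (hG : G ≤ B7Prop2Explicit.unitaryUnits (Matrix (Fin N) (Fin N) ℂ))
    {U : CfgY (Matrix (Fin N) (Fin N) ℂ) i} (hU : ∀ μ x, U μ x ∈ G) (Gop : BondOpY (Matrix (Fin N) (Fin N) ℂ) i)
    (hpos : PosDefTr (fun _ => (1 : ℝ)) (Gop U)) : PosDefTr (fun _ => (1 : ℝ)) (QGQOfY i (parBY i) Gop U) :=
  posDefTr_QGQOfY i hG (parBY i) U (fun s s' => parBY_mem i hU s s') Gop hpos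

/-- ★★ **`Q G Q*(U)` IS A UNIT** ((3.123): «ω = (QGQ*)⁻¹B»; (3.132)) for every letter with `G(U) > 0`, `G`-valued table, `G ≤ U(N)`.
[cite: Balaban1985BackgroundPropagators, (3.123) p.420, (3.132) p.422; Balaban1984PropagatorsII, (2.35) p.228 («an inverse is a well-defined and positive operator»)] -/
theorem isUnit_QGQOfY_of_posDefTr {G : Subgroup (Matrix (Fin N) (Fin N) ℂ)ˣ} (hG : G ≤ B7Prop2Explicit.unitaryUnits (Matrix (Fin N) (Fin N) ℂ))
    (parB : BondParY (Matrix (Fin N) (Fin N) ℂ) i) (U : CfgY (Matrix (Fin N) (Fin N) ℂ) i) (hpar : ∀ s s', parB U s s' ∈ G)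
    (Gop : BondOpY (Matrix (Fin N) (Fin N) ℂ) i) (hpos : PosDefTr (fun _ => (1 : ℝ)) (Gop U)) : IsUnit (QGQOfY i parB Gop U) :=
  isUnit_of_posDefTr (posDefTr_QGQOfY i hG parB U hpar Gop hpos)

/-- `Q G Q*(U)` is a unit at def-Y's `parBY` and a `G`-valued configuration. [cite: Balaban1985BackgroundPropagators, (3.123) p.420, (3.35) p.396] -/
theorem isUnit_QGQOfY_parBY_of_posDefTr {G : Subgroup (Matrix (Fin N) (Fin N) ℂ)ˣ} (hG : G ≤ B7Prop2Explicit.unitaryUnits (Matrix (Fin N) (Fin N) ℂ))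
    {U : CfgY (Matrix (Fin N) (Fin N) ℂ) i} (hU : ∀ μ x, U μ x ∈ G) (Gop : BondOpY (Matrix (Fin N) (Fin N) ℂ) i)
    (hpos : PosDefTr (fun _ => (1 : ℝ)) (Gop U)) : IsUnit (QGQOfY i (parBY i) Gop U) :=
  isUnit_of_posDefTr (posDefTr_QGQOfY_parBY i hG hU Gop hpos)

/-- `Q G₁ Q*(U) > 0` from `Δ⁽¹⁾(U) > 0` alone (`G₁ = Ring.inverse Δ⁽¹⁾` is positive definite, n06-j `posDefTr_ringInverse`).
[cite: Balaban1985BackgroundPropagators, (3.128)–(3.129) p.421, (3.132) p.422, (3.138) p.423] -/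
theorem posDefTr_QGQOfY_G1Y_of_posDefTr_deltaOneY {G : Subgroup (Matrix (Fin N) (Fin N) ℂ)ˣ}
    (hG : G ≤ B7Prop2Explicit.unitaryUnits (Matrix (Fin N) (Fin N) ℂ)) (parB : BondParY (Matrix (Fin N) (Fin N) ℂ) i)
    (U : CfgY (Matrix (Fin N) (Fin N) ℂ) i) (hpar : ∀ s s', parB U s s' ∈ G) (parS : SiteParY (Matrix (Fin N) (Fin N) ℂ) i)
    (Gp : SiteOpY (Matrix (Fin N) (Fin N) ℂ) i) (Δ2 : BondOpY (Matrix (Fin N) (Fin N) ℂ) i)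
    (hΔ1 : PosDefTr (fun _ => (1 : ℝ)) (deltaOneY i parS parB Gp Δ2 U)) :
    PosDefTr (fun _ => (1 : ℝ)) (QGQOfY i parB (G1Y i parS parB Gp Δ2) U) :=
  posDefTr_QGQOfY i hG parB U hpar _ (posDefTr_ringInverse hΔ1)

/-- ★★★ **THE DISPLAYED UNIT `hUQ` OF THE STAGE-11 CERTIFICATE FROM `Δ⁽¹⁾(U) > 0` ALONE: `Q G₁ Q*(U)` IS A UNIT** whenever
`Δ⁽¹⁾(U) = Δ_a − Δ′_π − Δ⁽²⁾_π` is positive definite in trace currency, at a `G`-valued table, `G ≤ U(N)` — `Q` onto ∕ `Q*` injective being automatic (§2).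
[cite: Balaban1985BackgroundPropagators, (3.132) p.422 («(QG₁Q*)⁻¹ … can be analyzed in the same way»), (3.128) p.421, (3.138) p.423] -/
theorem isUnit_QGQOfY_G1Y_of_posDefTr_deltaOneY {G : Subgroup (Matrix (Fin N) (Fin N) ℂ)ˣ}
    (hG : G ≤ B7Prop2Explicit.unitaryUnits (Matrix (Fin N) (Fin N) ℂ)) (parB : BondParY (Matrix (Fin N) (Fin N) ℂ) i)
    (U : CfgY (Matrix (Fin N) (Fin N) ℂ) i) (hpar : ∀ s s', parB U s s' ∈ G) (parS : SiteParY (Matrix (Fin N) (Fin N) ℂ) i)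
    (Gp : SiteOpY (Matrix (Fin N) (Fin N) ℂ) i) (Δ2 : BondOpY (Matrix (Fin N) (Fin N) ℂ) i)
    (hΔ1 : PosDefTr (fun _ => (1 : ℝ)) (deltaOneY i parS parB Gp Δ2 U)) : IsUnit (QGQOfY i parB (G1Y i parS parB Gp Δ2) U) :=
  isUnit_of_posDefTr (posDefTr_QGQOfY_G1Y_of_posDefTr_deltaOneY i hG parB U hpar parS Gp Δ2 hΔ1)

/-- **(3.137)–(3.138) IN TRACE CURRENCY**: a positive definite `T` minus a FORM-SMALL perturbation `D` (`⟨Φ, DΦ⟩ ≤ r·⟨Φ, TΦ⟩`, `r < 1`) is positive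
definite (print: «this bound implies that the operators Δ⁽²⁾, Δ_π⁽²⁾ are small in a proper sense … Similarly as in (3.130) we get G₁ = G₀(I − (Δ′_π + Δ_π⁽²⁾)G₀)⁻¹»;
here only the positivity half, no series). [cite: Balaban1985BackgroundPropagators, (3.137)–(3.138) p.423, (3.120) p.419] -/
theorem posDefTr_sub_of_form_small {w : S → ℝ} {T D : (S → Matrix (Fin N) (Fin N) ℂ) →ₗ[ℂ] (S → Matrix (Fin N) (Fin N) ℂ)} (hT : PosDefTr w T)
    {r : ℝ} (hr : r < 1) (hD : ∀ Φ, trIP w Φ (D Φ) ≤ r * trIP w Φ (T Φ)) : PosDefTr w (T - D) := by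
  intro Φ hΦ
  have hpos : 0 < trIP w Φ (T Φ) := hT Φ hΦ
  have hsplit : trIP w Φ (T Φ) = trIP w Φ ((T - D) Φ) + trIP w Φ (D Φ) := by
    rw [← trIP_add_right, LinearMap.sub_apply, sub_add_cancel]
  have hsmall := hD Φ
  nlinarith [mul_pos (sub_pos.mpr hr) hpos]

/-- `Δ⁽¹⁾(U) = Δ_{π,a}(U) − Δ⁽²⁾_π(U) > 0` from `Δ_{π,a}(U) > 0` ((3.122), Theorem-3.11 currency) and the FORM-SMALLNESS of `Δ⁽²⁾_π` relative to it ((3.137)).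
[cite: Balaban1985BackgroundPropagators, (3.128) p.421, (3.137)–(3.138) p.423] -/
theorem posDefTr_deltaOneY_of_form_small (parS : SiteParY (Matrix (Fin N) (Fin N) ℂ) i) (parB : BondParY (Matrix (Fin N) (Fin N) ℂ) i)
    (Gp : SiteOpY (Matrix (Fin N) (Fin N) ℂ) i) (Δ2 : BondOpY (Matrix (Fin N) (Fin N) ℂ) i) (U : CfgY (Matrix (Fin N) (Fin N) ℂ) i)
    (hπa : PosDefTr (fun _ => (1 : ℝ)) (deltaPiAY i parS parB Gp U)) {r : ℝ} (hr : r < 1)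
    (h2 : ∀ Φ, trIP (fun _ => (1 : ℝ)) Φ (delta2PiY i parS Gp Δ2 U Φ) ≤ r * trIP (fun _ => (1 : ℝ)) Φ (deltaPiAY i parS parB Gp U Φ)) :
    PosDefTr (fun _ => (1 : ℝ)) (deltaOneY i parS parB Gp Δ2 U) := by
  unfold deltaOneY
  exact posDefTr_sub_of_form_small hπa hr h2

/-- ★★★ `Q G₁ Q*(U)` IS A UNIT from `Δ_{π,a}(U) > 0` and the form-smallness of `Δ⁽²⁾_π(U)` ((3.137)–(3.138) reading), `G`-valued table, `G ≤ U(N)`.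
[cite: Balaban1985BackgroundPropagators, (3.132) p.422, (3.137)–(3.138) p.423] -/
theorem isUnit_QGQOfY_G1Y_of_form_small {G : Subgroup (Matrix (Fin N) (Fin N) ℂ)ˣ}
    (hG : G ≤ B7Prop2Explicit.unitaryUnits (Matrix (Fin N) (Fin N) ℂ)) (parB : BondParY (Matrix (Fin N) (Fin N) ℂ) i)
    (U : CfgY (Matrix (Fin N) (Fin N) ℂ) i) (hpar : ∀ s s', parB U s s' ∈ G) (parS : SiteParY (Matrix (Fin N) (Fin N) ℂ) i)
    (Gp : SiteOpY (Matrix (Fin N) (Fin N) ℂ) i) (Δ2 : BondOpY (Matrix (Fin N) (Fin N) ℂ) i)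
    (hπa : PosDefTr (fun _ => (1 : ℝ)) (deltaPiAY i parS parB Gp U)) {r : ℝ} (hr : r < 1)
    (h2 : ∀ Φ, trIP (fun _ => (1 : ℝ)) Φ (delta2PiY i parS Gp Δ2 U Φ) ≤ r * trIP (fun _ => (1 : ℝ)) Φ (deltaPiAY i parS parB Gp U Φ)) :
    IsUnit (QGQOfY i parB (G1Y i parS parB Gp Δ2) U) :=
  isUnit_QGQOfY_G1Y_of_posDefTr_deltaOneY i hG parB U hpar parS Gp Δ2 (posDefTr_deltaOneY_of_form_small i parS parB Gp Δ2 U hπa hr h2)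

/-- ★★★ CONSUMER SHAPE (n06-d edition 14's `hUQ`, tables of record `parSymY ∕ parBY ∕ GpY (parSymY)`, any residual letter `Δ⁽²⁾`): at a `G`-valued
configuration, `G ≤ U(N)`, `PosDefTr 1 (deltaOneY …)` ⟹ `IsUnit (QGQOfY i (parBY i) (G1Y i (parSymY i) (parBY i) (GpY i (parSymY i)) Δ2) U)`.
[cite: Balaban1985BackgroundPropagators, (3.132) p.422, (3.35) p.396] -/
theorem isUnit_QGQOfY_G1Y_record_of_posDefTr {G : Subgroup (Matrix (Fin N) (Fin N) ℂ)ˣ}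
    (hG : G ≤ B7Prop2Explicit.unitaryUnits (Matrix (Fin N) (Fin N) ℂ)) {U : CfgY (Matrix (Fin N) (Fin N) ℂ) i} (hU : ∀ μ x, U μ x ∈ G)
    (Δ2 : BondOpY (Matrix (Fin N) (Fin N) ℂ) i)
    (hΔ1 : PosDefTr (fun _ => (1 : ℝ)) (deltaOneY i (parSymY i) (parBY i) (GpY i (parSymY i)) Δ2 U)) :
    IsUnit (QGQOfY i (parBY i) (G1Y i (parSymY i) (parBY i) (GpY i (parSymY i)) Δ2) U) :=
  isUnit_QGQOfY_G1Y_of_posDefTr_deltaOneY i hG (parBY i) U (fun s s' => parBY_mem i hU s s') _ _ Δ2 hΔ1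

end Positive

end Literature.MathematicalPhysics.QuantumFieldTheory.Balaban1983to89.Node00
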